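import Mathlib.Analysis.Complex.CauchyIntegral
import Mathlib.Analysis.Fourier.AddCircle
import HarnessLib

/-!
# A periodic entire function of small exponential type is constant

Topic `Literature/Analysis/Complex`. Everything here is PROVED (no named facts, no definitions).

Let `G` be entire with a real period `T > 0`, `G(ω + T) = G(ω)`, and of exponential type `< 2π/T`
in the imaginary direction: `‖G(ω)‖ ≤ C e^{β |im ω|}` with `β T < 2π`. Then `G` is constant
(`apply_eq_apply_of_periodic_of_norm_le_exp`). This is the "mode extinction" form of Liouville's
theorem: in the variable `q = e^{2πiω/T}` the function `G` is a Laurent series `∑ aₙ qⁿ` on `ℂ∖0`,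
and the growth bound forces `aₙ = 0` for `n ≠ 0` because `|q|^{±1}` already grows like
`e^{2π|im ω|/T} ≫ e^{β|im ω|}`.

The proof is written without logarithms, via Fourier coefficients:
* `intervalIntegral_mul_exp_eq_of_periodic` — by Cauchy–Goursat on the rectangle
  `[0, T] × [b₁, b₂]` (Mathlib's `Complex.integral_boundary_rect_eq_zero_of_differentiableOn`),
  whose vertical sides cancel by periodicity, the coefficient integral
  `J_n(b) = ∫₀ᵀ G(x + ib) e^{2πin(x+ib)/T} dx` (`n ∈ ℤ`) does not depend on `b`;
* `‖J_n(b)‖ ≤ C T e^{β|b|} e^{-2πnb/T}`, and on the line `b = n t`, `t → +∞`, the right-hand side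
  tends to `0` when `n ≠ 0` (this is where `βT < 2π` enters), so `J_n ≡ 0` for `n ≠ 0`;
* `apply_eq_apply_of_periodic_of_integral_eq_zero` — a continuous `T`-periodic function on `ℝ`
  all of whose non-constant Fourier coefficients vanish is constant (its Fourier series on
  `AddCircle T`, Mathlib's `hasSum_fourier_series_of_summable`, reduces to the constant term);
* hence `G` is constant on `ℝ`, and on `ℂ` by the identity theorem
  (`AnalyticOnNhd.eq_of_frequently_eq`).

## References

* R. P. Boas, *Entire Functions* (1954), §6.10 (periodic entire functions of exponential type are
  trigonometric polynomials `∑_{|n| ≤ τT/2π} aₙ e^{2πinz/T}`). [folklore]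
* E. C. Titchmarsh, *The Theory of Functions*, 2nd ed. (1939), §2.5, §9.1. [folklore]
-/

noncomputable section

open Complex MeasureTheory Set Filter intervalIntegral Real Topology

namespace Literature.Analysis.Complex

/-- **A continuous periodic function with vanishing non-constant Fourier coefficients is
constant.** If `g : ℝ → ℂ` is continuous and `T`-periodic (`T > 0`) and
`∫₀ᵀ e^{2πinx/T} g(x) dx = 0` for every integer `n ≠ 0`, then `g x = g y` for all `x, y`
(the Fourier series of the lift of `g` to `AddCircle T` has summable — finitely supported —
coefficients, hence converges uniformly to the lift, and it reduces to the constant term).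
[folklore] -/
theorem apply_eq_apply_of_periodic_of_integral_eq_zero {g : ℝ → ℂ} {T : ℝ} (hT : 0 < T)
    (hg : Continuous g) (hper : Function.Periodic g T)
    (hzero : ∀ n : ℤ, n ≠ 0 →
      ∫ x in (0 : ℝ)..T, Complex.exp (2 * π * I * n * x / T) * g x = 0)
    (x y : ℝ) : g x = g y := by
  haveI : Fact (0 < T) := ⟨hT⟩
  have hcont : Continuous (hper.lift : AddCircle T → ℂ) := by
    have h : (hper.lift : AddCircle T → ℂ) ∘ (QuotientAddGroup.mk : ℝ → AddCircle T) = g := by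
      funext t; exact hper.lift_coe t
    rw [(QuotientAddGroup.isQuotientMap_mk _).continuous_iff, h]
    exact hg
  obtain ⟨F, hFapply⟩ : ∃ F : C(AddCircle T, ℂ), ∀ t : ℝ, F (t : AddCircle T) = g t :=
    ⟨⟨hper.lift, hcont⟩, fun t ↦ hper.lift_coe t⟩
  -- the non-constant Fourier coefficients of `F` vanish
  have hF : ∀ n : ℤ, n ≠ 0 → fourierCoeff F n = 0 := by
    intro n hn
    have h1 :
        (∫ t in (0 : ℝ)..0 + T, (fourier (-n)) (t : AddCircle T) • F (t : AddCircle T)) = 0 := by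
      rw [zero_add, ← hzero (-n) (neg_ne_zero.2 hn)]
      refine intervalIntegral.integral_congr fun t _ ↦ ?_
      simp only [fourier_coe_apply, hFapply, smul_eq_mul]
    rw [fourierCoeff_eq_intervalIntegral F n 0, h1, smul_zero]
  -- so the Fourier series of `F` is the single constant term, and it sums to `F`
  have hsummable : Summable (fourierCoeff F) := (hasSum_single 0 hF).summable
  have hlim : HasSum (fun i ↦ fourierCoeff F i • fourier i) F :=
    hasSum_fourier_series_of_summable hsummable
  have hsingle : HasSum (fun i ↦ fourierCoeff F i • (fourier i : C(AddCircle T, ℂ)))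
      (fourierCoeff F 0 • (fourier 0 : C(AddCircle T, ℂ))) :=
    hasSum_single 0 fun i hi ↦ by rw [hF i hi, zero_smul]
  have hFeq : F = fourierCoeff F 0 • (fourier 0 : C(AddCircle T, ℂ)) := hlim.unique hsingle
  have key : ∀ t : ℝ, g t = fourierCoeff F 0 := fun t ↦ by
    have h := DFunLike.congr_fun hFeq (t : AddCircle T)
    rw [hFapply, ContinuousMap.smul_apply, fourier_zero, smul_eq_mul, mul_one] at h
    exact h
  rw [key x, key y]

/-- **Independence of the coefficient integral of the ordinate.** If `G` is entire with real
period `T > 0`, then for `n ∈ ℤ` the integral `∫₀ᵀ G(x + ib) e^{2πin(x+ib)/T} dx` is the same for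
all real `b` (Cauchy–Goursat on `[0, T] × [b₁, b₂]`; the vertical sides cancel since
`w ↦ G(w) e^{2πinw/T}` is `T`-periodic). [folklore] -/
theorem intervalIntegral_mul_exp_eq_of_periodic {G : ℂ → ℂ} {T : ℝ} (hT : 0 < T)
    (hG : Differentiable ℂ G) (hper : ∀ ω : ℂ, G (ω + T) = G ω) (n : ℤ) (b₁ b₂ : ℝ) :
    ∫ x in (0 : ℝ)..T, G (x + b₁ * I) * Complex.exp (2 * π * I * n * (x + b₁ * I) / T) =
      ∫ x in (0 : ℝ)..T, G (x + b₂ * I) * Complex.exp (2 * π * I * n * (x + b₂ * I) / T) := by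
  set g : ℂ → ℂ := fun w ↦ G w * Complex.exp (2 * π * I * n * w / T) with hg
  have hgd : Differentiable ℂ g := by rw [hg]; fun_prop
  have hTne : (T : ℂ) ≠ 0 := ofReal_ne_zero.2 hT.ne'
  have hgper : ∀ w : ℂ, g (w + T) = g w := fun w ↦ by
    simp only [hg]
    rw [hper]
    have : 2 * π * I * n * (w + T) / T = 2 * π * I * n * w / T + n * (2 * π * I) := by
      field_simp
    rw [this, Complex.exp_add, Complex.exp_int_mul_two_pi_mul_I, mul_one]
  have h := Complex.integral_boundary_rect_eq_zero_of_differentiableOn g (b₁ * I) (T + b₂ * I)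
    hgd.differentiableOn
  have hre1 : ((b₁ : ℂ) * I).re = 0 := by simp
  have him1 : ((b₁ : ℂ) * I).im = b₁ := by simp
  have hre2 : ((T : ℂ) + b₂ * I).re = T := by simp
  have him2 : ((T : ℂ) + b₂ * I).im = b₂ := by simp
  rw [hre1, him1, hre2, him2] at h
  -- the vertical sides cancel
  have hvert : (∫ y : ℝ in b₁..b₂, g (((0 : ℝ) : ℂ) + y * I)) =
      ∫ y : ℝ in b₁..b₂, g (((T : ℝ) : ℂ) + y * I) := by
    refine intervalIntegral.integral_congr fun y _ ↦ ?_
    rw [← hgper]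
    push_cast
    ring_nf
  rw [hvert, add_sub_cancel_right] at h
  have := sub_eq_zero.1 h
  simpa [hg] using this

/-- **Liouville's theorem for periodic entire functions of small exponential type (mode
extinction).** Let `G` be entire with real period `T > 0` and `‖G(ω)‖ ≤ C e^{β|im ω|}` with
`βT < 2π`. Then `G` is constant: `G z = G w` for all `z, w`. (All Fourier–Laurent coefficients
`aₙ`, `n ≠ 0`, of `G` vanish, since `|aₙ| ≤ C e^{β|b|} e^{-2πnb/T}` for every `b`, which tends to
`0` along `b = nt → ±∞` because `2π|n|/T > β`; so `G` is constant on `ℝ`, hence on `ℂ`.)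
Boas, *Entire Functions*, §6.10. [folklore] -/
theorem apply_eq_apply_of_periodic_of_norm_le_exp {G : ℂ → ℂ} {T β C : ℝ} (hT : 0 < T)
    (hβT : β * T < 2 * π) (hG : Differentiable ℂ G) (hper : ∀ ω : ℂ, G (ω + T) = G ω)
    (hbound : ∀ ω : ℂ, ‖G ω‖ ≤ C * Real.exp (β * |ω.im|)) (z w : ℂ) : G z = G w := by
  have hC : 0 ≤ C := by
    have h := hbound 0
    simp only [zero_im, abs_zero, mul_zero, Real.exp_zero, mul_one] at h
    exact (norm_nonneg _).trans h
  -- the coefficient integrals `J n b = ∫₀ᵀ G(x + ib) e^{2πin(x+ib)/T} dx`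
  set J : ℤ → ℝ → ℂ := fun n b ↦
    ∫ x in (0 : ℝ)..T, G (x + b * I) * Complex.exp (2 * π * I * n * (x + b * I) / T) with hJ
  have hJeq : ∀ (n : ℤ) (b₁ b₂ : ℝ), J n b₁ = J n b₂ := fun n b₁ b₂ ↦
    intervalIntegral_mul_exp_eq_of_periodic hT hG hper n b₁ b₂
  -- the bound on the line `im ω = b`
  have hJle : ∀ (n : ℤ) (b : ℝ),
      ‖J n b‖ ≤ C * Real.exp (β * |b|) * Real.exp (-(2 * π * n * b / T)) * T := by
    intro n b
    have h := intervalIntegral.norm_integral_le_of_norm_le_const (a := 0) (b := T)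
      (C := C * Real.exp (β * |b|) * Real.exp (-(2 * π * n * b / T)))
      (f := fun x : ℝ ↦ G (x + b * I) * Complex.exp (2 * π * I * n * (x + b * I) / T)) ?_
    · simpa only [sub_zero, abs_of_pos hT] using h
    intro x _
    rw [norm_mul, Complex.norm_exp]
    have hre : (2 * π * I * n * (x + b * I) / T).re = -(2 * π * n * b / T) := by
      simp only [div_ofReal_re, mul_re, mul_im, re_ofNat, im_ofNat, ofReal_re, ofReal_im, I_re,
        I_im, intCast_re, intCast_im, add_re, add_im]
      ring
    have him : ((x : ℂ) + b * I).im = b := by simp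
    rw [hre]
    refine mul_le_mul_of_nonneg_right ?_ (Real.exp_pos _).le
    simpa only [him] using hbound (x + b * I)
  -- the coefficients with `n ≠ 0` vanish
  have hJzero : ∀ n : ℤ, n ≠ 0 → J n 0 = 0 := by
    intro n hn
    have hκ : 0 < 2 * π / T - β := by
      rw [sub_pos, lt_div_iff₀ hT]
      exact hβT
    have hn1 : (1 : ℝ) ≤ |(n : ℝ)| := by exact_mod_cast Int.one_le_abs hn
    have hle : ∀ t : ℝ, 0 ≤ t → ‖J n 0‖ ≤ C * T * Real.exp (-(t * (2 * π / T - β))) := by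
      intro t ht
      have hm0 : 0 ≤ t * (|(n : ℝ)| - 1) * (2 * π / T * (|(n : ℝ)| + 1) - β) := by
        refine mul_nonneg (mul_nonneg ht (by linarith)) ?_
        have : 0 < 2 * π / T := by positivity
        nlinarith
      have key : β * |(n : ℝ) * t| + -(2 * π * n * (n * t) / T) ≤ -(t * (2 * π / T - β)) := by
        have h1 : (n : ℝ) * n = |(n : ℝ)| * |(n : ℝ)| := (abs_mul_abs_self _).symm
        have h2 : 2 * π * (n : ℝ) * (n * t) / T = 2 * π / T * ((n : ℝ) * n) * t := by ring
        rw [abs_mul, abs_of_nonneg ht, h2, h1]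
        linarith [hm0]
      rw [hJeq n 0 (n * t)]
      calc ‖J n (n * t)‖
          ≤ C * Real.exp (β * |(n : ℝ) * t|) * Real.exp (-(2 * π * n * (n * t) / T)) * T :=
            hJle n (n * t)
        _ = C * T * (Real.exp (β * |(n : ℝ) * t|) * Real.exp (-(2 * π * n * (n * t) / T))) := by
            ring
        _ ≤ C * T * Real.exp (-(t * (2 * π / T - β))) := by
            refine mul_le_mul_of_nonneg_left ?_ (mul_nonneg hC hT.le)
            rw [← Real.exp_add]
            exact Real.exp_le_exp.2 key
    have hlim : Tendsto (fun t : ℝ ↦ C * T * Real.exp (-(t * (2 * π / T - β)))) atTop (𝓝 0) := by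
      have h := (Real.tendsto_exp_neg_atTop_nhds_zero.comp
        (tendsto_id.atTop_mul_const hκ)).const_mul (C * T)
      rw [mul_zero] at h
      exact h
    have h0 : ‖J n 0‖ ≤ 0 :=
      le_of_tendsto_of_tendsto tendsto_const_nhds hlim
        ((eventually_ge_atTop 0).mono fun t ht ↦ hle t ht)
    exact norm_le_zero_iff.1 h0
  -- hence `G` is constant on the real axis ...
  have hreal : ∀ x : ℝ, G x = G (1 : ℝ) := by
    intro x
    refine apply_eq_apply_of_periodic_of_integral_eq_zero (g := fun t : ℝ ↦ G t) hT
      (hG.continuous.comp continuous_ofReal) (fun t ↦ ?_) (fun n hn ↦ ?_) x 1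
    · show G ((t + T : ℝ) : ℂ) = G t
      push_cast
      exact hper t
    · have h := hJzero n hn
      simp only [hJ, ofReal_zero, zero_mul, add_zero] at h
      rw [← h]
      refine intervalIntegral.integral_congr fun t _ ↦ ?_
      show Complex.exp (2 * π * I * n * t / T) * G t = G t * Complex.exp (2 * π * I * n * t / T)
      ring
  -- ... and on `ℂ`, by the identity theorem
  have hconst : G = fun _ ↦ G (1 : ℝ) := by
    have h1 : AnalyticOnNhd ℂ G univ := hG.differentiableOn.analyticOnNhd isOpen_univ
    have h2 : AnalyticOnNhd ℂ (fun _ : ℂ ↦ G (1 : ℝ)) univ := analyticOnNhd_const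
    have h3 : Tendsto ((↑) : ℝ → ℂ) (𝓝[≠] 1) (𝓝[≠] 1) := by
      rw [tendsto_nhdsWithin_iff]
      constructor
      · exact tendsto_nhdsWithin_of_tendsto_nhds continuous_ofReal.continuousAt
      · exact eventually_nhdsWithin_iff.mpr (Eventually.of_forall fun t ht ↦ ofReal_ne_one.mpr ht)
    refine AnalyticOnNhd.eq_of_frequently_eq h1 h2 (h3.frequently ?_)
    exact Eventually.frequently (Eventually.of_forall fun t ↦ hreal t)
  rw [congrFun hconst z, congrFun hconst w]

end Literature.Analysis.Complex
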